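import Summits.QuantumFields.YangMills.Theorems.BalabanUVNodesPortS1ClassP2Defs

/-!
# NODE O port PT-A — TWO MORE PRINT-SHAPED CLASS LETTERS FOR THE ε₀-CLASS EDITION OF THE LZ HALF (g11, located the same hour on nodeO STATUS): `ClassP5Reg F` — row (P5) of the P0-ℂ letter
# (positivity + two-sided form bounds of the (2.11) matrix `recordPreckLoc ∘ portVkAx`) AT EVERY POINT OF ONE ε₀-REGULAR CLASS (the germ row `P0CarrierClauses` :160 widened, same quantifier
# order as ✓`ClassP2Reg`), and `ClassNestsUc F` — print's nesting «U_k(ε₀) ⊂ U^c_j(X, α₀, α₁)» (p.263 L5–13) at the record: every class point CUTS INTO the record spaces (✓`CutsInUc`)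

Cell `ym-nodeO-ideate`, porter seat PT-A-1 (gen 11); `--supports stmt-QuantumFields-27930 --as helper`; count-neutral; definition kind (two `def … : Prop` with the parameter `F`, nothing else).
[I] = [Balaban1987RG1]; [15] = [Balaban1985Variational].

WHY (located; ✓`…LZdetGerm.eventually_phiLZdet_eq_sum_lzdetPiece`'s hypotheses read one by one against the class).  The (63) identity `phiLZdet n B = Σ_X lzdetPiece … (recordPairJ … B)` at a chart
point `B` consumes: (P2) at `B` (✓`ClassP2Reg` on the class), the letter `RecordB0BlockInvertible` at `V^{(k)}_{ax}(W_B)` (a THEOREM on the class, ✓`…ClassTwins`), `PosDef` + the upper form bound of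
`T(B) = recordPreckLoc … (portVkAx … B) …` (row (P5) — GERM-ONLY in `P0CarrierClauses`; `PosDef` is essential: `phiLZdet(B)` equals `−½[log det T(B) − log det T(0)]` only where the Gaussian
`Z^{(k)}_loc` converges, ✓`phiLZdet_eq_logDet₀`), and the Schur decay of the carrier pieces ∕ the x-continuity of the G3C resolvent pieces AT the pair of `U_{k+1}(W_B)` — granted by (P4) ∕ (g2)(g3)(g5)
ONLY on the record spaces `recordUc … α₀ α₁ … X`, i.e. the class pair must CUT INTO them (✓`CutsInUc`).  The first is (P5) widened to the class; the second is print's p.263 L5–13 nesting, which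
rests on [15] Thm 1's REGULARITY of the minimiser ((1.12)'s cube clause `|∇^ξ A| < c_B α₀` in a local gauge is NOT implied by small plaquettes alone — in an axial gauge `∇₂A₂` is a sum of up to
`Mξ⁻¹` plaquette DIFFERENCES; the field equation bounds them) — P0-ℝ-class, the same wall as ◆ CRIT-1 g40's finding (F).  Both are BY-PRODUCTS of the P0C ∕ P0-ℝ supply on the critical path of
`stub_P0C` (no new socket recommended; this seat's nodeO line of this hour).

WHAT THIS FILE IS.  §1 `ClassP5Reg` — quantifier order IDENTICAL to ✓`ClassP2Reg` (`ε₀` after `(Mc, a₀, ε₂₉)` and the P0 constants `(δ₀, c₀, γ₀, γ₁, α₀, α₁)`, before `k`, the carriers, `n`, `B`;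
the carriers enter only through the guard `P0CarrierClauses … →`, which pins `(γ₀, γ₁)` to the supplier's (E2) constants).  §2 `ClassNestsUc` — carrier-free (`ε₀` after `(Mc, a₀, ε₂₉, α₀, α₁)`,
before `k n B`); its body is EXACTLY the `hnest` hypothesis of ✓`representsOnRegW_of_onUc_of_nesting` (✓`…FEStepReg` :104) with `∃ ε₀` in front.  Consumed by PT-A's brick
`lzHalfReg_of_P0C_of_classP2 : (∀F, P0HolExtAtRecordGL F) → (∀F, ClassP2Reg F) → (∀F, ClassP5Reg F) → (∀F, ClassNestsUc F) → ∀F, PortRecordLZHalfReg F` (g11, part D).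

v2 (§3): + `ClassP5NestReg` — the ONE carrier-free letter ★★★ director-ym №633 rules on (◆ C34 (t1)–(t3)); §1–§2 unchanged.

HONEST FRAMING.  Three `Prop`s, asserted for nothing, inhabited nowhere; print-shaped ([I] (2.11)–(2.12) «on U_k(ε₀)», p.263 L5–13); `PortRecordLZHalfReg` ∕ `P0HolExtAtRecordGL` ∕ `ClassP2Reg` ∕
`FEStepReg` inhabited NOWHERE; `stub_P0C`∕`stub_LZhalfReg`∕`stub_FEstepReg` OPEN; ⟨27930⟩ OPEN 1∕4; ⟨26900⟩ 0∕4; NODE O 0∕1; COUNT 8∕28 · K 1∕4 UNMOVED; finite `𝕋⁴_{L^K}` at fixed ε — NOT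
continuum ∕ OS; **the Yang–Mills mass gap (Clay) is NOT proved by any of this.**  No `sorry`, no `instance`, no theorem; standard axioms.
-/

noncomputable section

open scoped BigOperators Matrix.Norms.L2Operator Topology
open Filter Set

namespace Summit.QuantumFields.YangMills.Theorems.BalabanUVNodesPortS1

open Summit.QuantumFields.YangMills.Theorems.K0RecordFormatNames
open Literature.MathematicalPhysics.QuantumFieldTheory.Balaban1983to89
open Literature.MathematicalPhysics.QuantumFieldTheory.Balaban1983to89.Node00
open Literature.MathematicalPhysics.QuantumFieldTheory.Balaban1983to89.T4Continuum (T4Family)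
open _root_.Matrix

/-! ## §1  Row (P5) of the P0-ℂ letter on the ε₀-regular class -/

/-- ★ **`ClassP5Reg F` — POSITIVITY AND THE TWO-SIDED FORM BOUNDS OF THE (2.11) MATRIX ON PRINT's CLASS**: for every admissible `Mc`, radii `a₀, ε₂₉ > 0` and P0 constants
`(δ₀, c₀, γ₀, γ₁, α₀, α₁)` there is ONE class radius `ε₀ > 0`, uniform in `k`, `n` and in the carriers, such that for every carrier family with the P0-ℂ body at level `k` and every chart point `B` of
the ε₀-regular class, `T(B) := recordPreckLoc … a₀ (portVkAx … B) (hopLinGraph … (portVkAx … B))` is positive definite with `γ₀|v|² ≤ ⟨v, T(B)v⟩ ≤ γ₁|v|²` — `P0CarrierClauses`' germ row (P5) at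
every class point; print's (2.11)–(2.12) «on the spaces U_k(ε₀)» with [15] (E2)'s spectral constants.  A `Prop`; asserted for nothing.
[cite: Balaban1987RG1, (2.11)–(2.12) pp.267–268, (1.1)–(1.2) p.260, p.264 (Thm 3 «on the spaces U_k(ε₀)»); Balaban1985Variational, (117) p.295, Prop. 9 p.309] -/
def ClassP5Reg (F : T4Family) : Prop :=
  ∀ (Mc : ℕ) (a₀ ε₂₉ δ₀ c₀ γ₀ γ₁ α₀ α₁ : ℝ), McGuard F Mc → 0 < a₀ → 0 < ε₂₉ →
    ∃ ε₀ : ℝ, 0 < ε₀ ∧ ∀ (k : ℕ) TC TY TZY AdM AdZ, P0CarrierClauses F a₀ δ₀ c₀ γ₀ γ₁ Mc α₀ α₁ ε₂₉ k TC TY TZY AdM AdZ →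
      ∀ (n : ℕ) (B : recordW F a₀ ε₂₉ k (recordK₀ F Mc k + n)), InRegClass F Mc k ε₀ a₀ ε₂₉ n B →
        (recordPreckLoc F k (recordK₀ F Mc k + n) a₀ (portVkAx F a₀ ε₂₉ k (recordK₀ F Mc k + n) B)
            (hopLinGraph F k (recordK₀ F Mc k + n) (portVkAx F a₀ ε₂₉ k (recordK₀ F Mc k + n) B))).PosDef ∧
        ∀ v : NonB0Idx F k (recordK₀ F Mc k + n) → ℝ,
          γ₀ * dotProduct v v ≤
              dotProduct v (Matrix.mulVec (recordPreckLoc F k (recordK₀ F Mc k + n) a₀ (portVkAx F a₀ ε₂₉ k (recordK₀ F Mc k + n) B)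
                (hopLinGraph F k (recordK₀ F Mc k + n) (portVkAx F a₀ ε₂₉ k (recordK₀ F Mc k + n) B))) v) ∧
            dotProduct v (Matrix.mulVec (recordPreckLoc F k (recordK₀ F Mc k + n) a₀ (portVkAx F a₀ ε₂₉ k (recordK₀ F Mc k + n) B)
                (hopLinGraph F k (recordK₀ F Mc k + n) (portVkAx F a₀ ε₂₉ k (recordK₀ F Mc k + n) B))) v) ≤
              γ₁ * dotProduct v v

/-! ## §2  Print's nesting `U_k(ε₀) ⊂ U^c_j(X, α₀, α₁)` at the record -/

/-- ★ **`ClassNestsUc F` — EVERY POINT OF ONE ε₀-REGULAR CLASS CUTS INTO ALL THE RECORD SPACES `U^c_{k+1}(X, α₀, α₁)`**: for every admissible `Mc`, radii `a₀, ε₂₉ > 0` and `α₀, α₁ > 0` there is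
ONE `ε₀ > 0`, uniform in `k, n`, with `InRegClass … ε₀ … B → CutsInUc … α₀ α₁ … B` (every (1.9) pair of `U_{k+1}(W_B)` cut to `X` satisfies (i)–(iv) of record modulo a `Gᶜ`-gauge) — print's
«the configurations from U_k(ε₀) restricted to X belong to U^c_j(X, α₀, α₁) for ε₀ sufficiently small» (p.263 L5–13), whose (1.12) gradient clause is [15] Thm 1's regularity of the minimiser.
The body is the `hnest` hypothesis of ✓`representsOnRegW_of_onUc_of_nesting`.  A `Prop`; asserted for nothing.
[cite: Balaban1987RG1, p.263 L5–13, (1.11)–(1.16) p.262, (1.1)–(1.2) p.260; Balaban1985Variational, Thm 1 p.279, (19)–(20) p.281] -/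
def ClassNestsUc (F : T4Family) : Prop :=
  ∀ (Mc : ℕ) (a₀ ε₂₉ α₀ α₁ : ℝ), McGuard F Mc → 0 < a₀ → 0 < ε₂₉ → 0 < α₀ → 0 < α₁ →
    ∃ ε₀ : ℝ, 0 < ε₀ ∧ ∀ (k n : ℕ) (B : recordW F a₀ ε₂₉ k (recordK₀ F Mc k + n)),
      InRegClass F Mc k ε₀ a₀ ε₂₉ n B → CutsInUc F Mc k α₀ α₁ a₀ ε₂₉ n B

/-! ## §3  (v2, ★★★ director-ym №633 (a)–(c) ∕ ◆ C34 (t1)–(t3)) THE ONE CARRIER-FREE CLASS LETTER `ClassP5NestReg` -/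

/-- ★★ **`ClassP5NestReg F` — PRINT's (2.11) POSITIVITY AND THE p.263 NESTING ON THE ε₀-CLASS, CARRIER-FREE** (the letter ★★★ №633 rules on; §1–§2 above are the g11 first cut, kept as
Props asserted for nothing — `ClassNestsUc` is this letter's last conjunct verbatim, `ClassP5Reg` the stronger (E2)-keyed edition with P0C's own `γ₀ γ₁`): for every admissible `Mc`, radii
`a₀, ε₂₉ > 0` and `α₀, α₁ > 0` there are ONE class radius `ε₀ > 0` and ONE form constant `γ′ > 0` — chosen AFTER `(Mc, a₀, ε₂₉, α₀, α₁)`, BEFORE the level `k`, the volume index `n` and the class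
point `B` (uniformity in `k, n, B` is the content) — such that at every chart point `B` of the ε₀-regular class the REAL `(2.11)` matrix over the non-`b₀` index
`T(B) := recordPreckLoc F k K a₀ (portVkAx … B) (hopLinGraph … (portVkAx … B)) : Matrix (NonB0Idx F k K) (NonB0Idx F k K) ℝ` is positive definite (`Matrix.PosDef` of the real matrix:
symmetric ∧ positive form) with `⟨v, T(B) v⟩ ≤ γ′ |v|²`, AND `B` cuts into all the record spaces (`CutsInUc … α₀ α₁ … B`: every (1.9) pair of `U_{k+1}(W_B)` cut to `X` lies in
`U^c_{k+1}(X, α₀, α₁)`) — print's (2.11)–(2.12) «on the spaces U_k(ε₀)» and «the configurations from U_k(ε₀) restricted to X belong to U^c_j(X, α₀, α₁)» (p.263 L5–13).  No carrier, no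
clause of `P0CarrierClauses`, (P2), `G3CPiecesAt` or `PortRecordLZHalfReg` inside.  INTENDED SUPPLIER (named per №633 (c)): DISCHARGED BY THE P0C ∕ P0-ℝ SUPPLIER — [15] Thm 1's regularity of
the minimiser (the (1.12) gradient clause of the nesting) + the (2.11) Hessian positivity at guarded real backgrounds — ON THE SAME CRITICAL PATH AS (P2)-class (`ClassP2Reg`) and `stub_P0C`;
ONE wall, not three letters.  A `Prop`; asserted for nothing; consumed by ★★★`lzHalfReg_of_P0C_of_classP2_of_classP5Nest` (✓`…PortS1LZHalfRegL`).
[cite: Balaban1987RG1, (2.11)–(2.12) pp.267–268, p.263 L5–13, (1.11)–(1.16) p.262, (1.1)–(1.2) p.260; Balaban1985Variational, Thm 1 p.279, (117) p.295, Prop. 9 p.309] -/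
def ClassP5NestReg (F : T4Family) : Prop :=
  ∀ (Mc : ℕ) (a₀ ε₂₉ α₀ α₁ : ℝ), McGuard F Mc → 0 < a₀ → 0 < ε₂₉ → 0 < α₀ → 0 < α₁ →
    ∃ ε₀ γ' : ℝ, 0 < ε₀ ∧ 0 < γ' ∧ ∀ (k n : ℕ) (B : recordW F a₀ ε₂₉ k (recordK₀ F Mc k + n)), InRegClass F Mc k ε₀ a₀ ε₂₉ n B →
      (recordPreckLoc F k (recordK₀ F Mc k + n) a₀ (portVkAx F a₀ ε₂₉ k (recordK₀ F Mc k + n) B)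
          (hopLinGraph F k (recordK₀ F Mc k + n) (portVkAx F a₀ ε₂₉ k (recordK₀ F Mc k + n) B))).PosDef ∧
      (∀ v : NonB0Idx F k (recordK₀ F Mc k + n) → ℝ,
        dotProduct v (Matrix.mulVec (recordPreckLoc F k (recordK₀ F Mc k + n) a₀ (portVkAx F a₀ ε₂₉ k (recordK₀ F Mc k + n) B)
            (hopLinGraph F k (recordK₀ F Mc k + n) (portVkAx F a₀ ε₂₉ k (recordK₀ F Mc k + n) B))) v) ≤ γ' * dotProduct v v) ∧
      CutsInUc F Mc k α₀ α₁ a₀ ε₂₉ n B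

end Summit.QuantumFields.YangMills.Theorems.BalabanUVNodesPortS1

end
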